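import Mathlib
import HarnessLib
import Summits.Langlands.Langlands.Theses.SkinnerWilesDefectOne
import Summits.Langlands.Langlands.Theorems.SkinnerWilesDefectOneReducibleOrdinaryProModularDefs
import Summits.Langlands.Langlands.Theorems.SkinnerWilesDefectOneReducibleOrdinaryProModularFineSelmerDefs
import Summits.Langlands.Langlands.Theorems.SkinnerWilesDefectOneReducibleOrdinaryProModularPatchingPrimeSupplyAux
import Summits.Langlands.Langlands.Theorems.SkinnerWilesDefectOneProModularOfEisensteinSeedReducibleLocus
import Summits.Langlands.Langlands.Theorems.SkinnerWilesDefectOneProModularOfEisensteinSeedNicePrimeSupply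
import Literature.NumberTheory.GaloisRepresentations.NearlyOrdinaryDeformationRing

/-!
# Stub (supply) `stub_patchingPrimeSupply`: above every big prime of `R_𝒟` there is a patching prime

Route `SkinnerWilesDefectOne`, crux `ReducibleOrdinaryProModular` (stmt-Langlands-12919), line
`fine-selmer-codimension-two` (lead skeleton v2,
`Cruxes/ReducibleOrdinaryProModular/Lines/fine_selmer_codimension_two.lean`), registered stub
`stub_patchingPrimeSupply` — the "supply" half of Skinner–Wiles' Prop. 4.1 ([SW, §4.3, p. 65]:
"Let `𝔭 ⊇ Q₁` be a prime of dimension one not containing `c_{σ₀}, Y₁, …, Y_t`. Such a `𝔭` always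
exists."), in the form the propagation theorem `Theorems.proMod_of_propagation` consumes at defect
one: for an SW-oriented model `M` and a BIG prime `Q` of `R = R_𝒟` (`dim R/Q ≥ 3`, `Q ∉ Z^red`) at
which every nearly-ordinary inertial ratio `ψ₁⁽ᵛ⁾/ψ₂⁽ᵛ⁾ mod Q` (`v ∣ p`) has infinite order, some
prime `𝔭 ⊇ Q` is a PATCHING prime (`IsPatchingPrime`: `dim R/𝔭 = 1`, `𝔭 ∉ Z^red`, ratios of
infinite order mod `𝔭`).  Sorry-free; pure commutative algebra over the tree's interface:

* `not_isOfFinOrder_unitsMap_comp_iff` — `χ mod P` has infinite order iff `J_n ⊄ P` for all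
  `n ≥ 1`, `J_n = ⟨χ(g)ⁿ − 1 : g⟩`: the bad loci are the COUNTABLY many closed sets `V(J_{v,n})`
  together with the reducible locus `Z^red = V(B₀)` (closed by the landed
  `Theorems.isClosed_reducibleLocus'`, which uses `p`-distinguishedness of the datum — the only SW
  hypothesis consumed), none containing `V(Q)`;
* `stub_patchingPrimeSupply` (and its registered alias `stub_patchingPrimeSupply_auxSupply`) — by
  `Theorems.exists_isPrime_ringKrullDim_quotient_eq_one_forall_not_le`
  of the helper file `…PatchingPrimeSupplyAux.lean` (countable prime avoidance in the COMPLETE local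
  ring `R_𝒟` — Burch, Sharp–Vámos — and Krull's principal ideal theorem, by induction on `dim R/Q`).

References: C. M. Skinner, A. J. Wiles, *Residually reducible representations and modular forms*,
Publ. Math. IHÉS 89 (1999) 5–126, §2.3, §4.2 (nice primes), §4.3 proof of Prop. 4.1
[SkinnerWiles1999]; H. Matsumura, *Commutative Ring Theory* (1986), Thms. 8.10, 13.5 [Matsumura1987].
-/

set_option linter.dupNamespace false -- project-wide option (lakefile weak.linter.dupNamespace); `Summit.Langlands.Langlands` is the mandated namespace

namespace Summit.Langlands.Langlands.Cruxes.ReducibleOrdinaryProModular.FineSelmerCodimensionTwo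

open scoped NumberField MatrixGroups
open Filter NumberField IsDedekindDomain Field Matrix
open Literature.NumberTheory.Automorphic Literature.NumberTheory.Automorphic.BigHeckeGLn
open Literature.NumberTheory.GaloisRepresentations
open Summit.Langlands.Langlands.Theses.SkinnerWilesDefectOne
open Summit.Langlands.Langlands.Cruxes.ReducibleOrdinaryProModular.SteinbergHyperplane

noncomputable section

/-- **Infinite order modulo a prime as countably many non-containments.**  For a character
`χ : G → Rˣ` and an ideal `P`, `χ mod P` is NOT of finite order iff for every `n ≥ 1` the ideal
`J_n = ⟨χ(g)ⁿ − 1 : g ∈ G⟩` is not contained in `P` (the closed sets `V(J_n)` of the supply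
argument). [folklore] -/
theorem not_isOfFinOrder_unitsMap_comp_iff {R G : Type*} [CommRing R] [Monoid G] (P : Ideal R)
    (χ : G →* Rˣ) :
    ¬ IsOfFinOrder ((Units.map (Ideal.Quotient.mk P : R →* R ⧸ P)).comp χ) ↔
      ∀ n : ℕ, ¬ Ideal.span (Set.range fun g => ((χ g ^ (n + 1) : Rˣ) : R) - 1) ≤ P := by
  have key : ∀ n : ℕ, ((Units.map (Ideal.Quotient.mk P : R →* R ⧸ P)).comp χ) ^ n = 1 ↔
      Ideal.span (Set.range fun g => ((χ g ^ n : Rˣ) : R) - 1) ≤ P := fun n => by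
    rw [Ideal.span_le, Set.range_subset_iff, MonoidHom.ext_iff]
    refine forall_congr' fun g => ?_
    rw [MonoidHom.pow_apply, MonoidHom.one_apply, MonoidHom.comp_apply, ← map_pow, Units.ext_iff,
      Units.coe_map, Units.val_one, MonoidHom.coe_coe, SetLike.mem_coe,
      ← (Ideal.Quotient.mk P).map_one, Ideal.Quotient.eq]
  rw [isOfFinOrder_iff_pow_eq_one, not_exists]
  constructor
  · intro h n hle
    exact h (n + 1) ⟨Nat.succ_pos n, (key (n + 1)).mpr hle⟩
  · rintro h n ⟨hn, hfn⟩
    obtain ⟨k, rfl⟩ := Nat.exists_eq_add_of_le' hn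
    exact h k ((key (k + 1)).mp hfn)

/-- **Stub (supply) `stub_patchingPrimeSupply` — above every big prime there is a patching prime.**
For any model `M` (SW-oriented, over an imaginary quadratic `F`, `p` odd; only distinguishedness at
`v ∣ p` is used, to know that the reducible locus `Z^red` is Zariski CLOSED): if `Q` is a prime of
`R = R_𝒟` with `dim R/Q ≥ 3`, `Q ∉ Z^red`, and `ψ₁⁽ᵛ⁾/ψ₂⁽ᵛ⁾ mod Q` of infinite order for every
`v ∣ p`, then some prime `𝔭 ⊇ Q` has `dim R/𝔭 = 1`, `𝔭 ∉ Z^red`, and ratios of infinite order mod `𝔭`.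
Proof: the bad loci in `V(Q)` are `V(B₀)`, `B₀` the vanishing ideal of the closed set `Z^red`
(`B₀ ⊄ Q`), and `V(J_{v,n})`, `J_{v,n} = ⟨(ψ₁/ψ₂)(g)ⁿ − 1⟩`, `n ≥ 1`, `v ∣ p` (finitely many `v`),
`J_{v,n} ⊄ Q` by the infinite order mod `Q` (`not_isOfFinOrder_unitsMap_comp_iff`): COUNTABLY many
ideals not contained in `Q`; `exists_isPrime_ringKrullDim_quotient_eq_one_forall_not_le`
(countable prime avoidance in the complete local ring `R_𝒟` + Krull) gives the dimension-one `𝔭`.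
[cite: SkinnerWiles1999, §4.3 proof of Prop. 4.1 (p. 65, "Such a `𝔭` always exists")] -/
theorem stub_patchingPrimeSupply :
    ∀ (F : Type) [Field F] [NumberField F], IsTotallyComplex F → Module.finrank ℚ F = 2 →
      ∀ (p : ℕ) [Fact p.Prime], p ≠ 2 →
      ∀ M : ModelData F p, M.IsSWOriented p →
        ∀ Q : PrimeSpectrum M.𝓡.R, IsBigPrime M.𝓡 Q →
          (∀ (v : HeightOneSpectrum (𝓞 F)) (hv : (p : 𝓞 F) ∈ v.asIdeal),
              ¬ IsOfFinOrder ((Units.map (Ideal.Quotient.mk Q.asIdeal : M.𝓡.R →* M.𝓡.R ⧸ Q.asIdeal)).comp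
                (M.𝓡.subChar v hv / M.𝓡.quotChar v hv))) →
          ∃ 𝔭 : PrimeSpectrum M.𝓡.R, Q ≤ 𝔭 ∧ IsPatchingPrime M.𝓡 𝔭 := by
  intro F _ _ _ _ p _ _ M hSW Q hQ hord
  classical
  obtain ⟨hQ3, hQred⟩ := hQ
  -- the reducible locus is closed: `Z^red = V(B₀)`
  have hZ : IsClosed M.𝓡.reducibleLocus :=
    Theorems.isClosed_reducibleLocus' M.𝓡 hSW.isDistinguishedAt
  set B₀ : Ideal M.𝓡.R := PrimeSpectrum.vanishingIdeal M.𝓡.reducibleLocus with hB₀def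
  have hZeq : PrimeSpectrum.zeroLocus (B₀ : Set M.𝓡.R) = M.𝓡.reducibleLocus := by
    rw [hB₀def, PrimeSpectrum.zeroLocus_vanishingIdeal_eq_closure, hZ.closure_eq]
  have hmemZ : ∀ P : PrimeSpectrum M.𝓡.R, P ∈ M.𝓡.reducibleLocus ↔ B₀ ≤ P.asIdeal := fun P => by
    rw [← hZeq, PrimeSpectrum.mem_zeroLocus, SetLike.coe_subset_coe]
  -- the ideals `J_{v,n}`
  let J : ∀ v : HeightOneSpectrum (𝓞 F), (p : 𝓞 F) ∈ v.asIdeal → ℕ → Ideal M.𝓡.R :=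
    fun v hv n => Ideal.span (Set.range fun g =>
      (((M.𝓡.subChar v hv / M.𝓡.quotChar v hv) g ^ (n + 1) : (M.𝓡.R)ˣ) : M.𝓡.R) - 1)
  -- the places above `p` are finitely many
  set T : Set (HeightOneSpectrum (𝓞 F)) := {v | (p : 𝓞 F) ∈ v.asIdeal} with hTdef
  have hT : T.Finite := by
    have hp0 : Ideal.span {(p : 𝓞 F)} ≠ ⊥ := by
      rw [Ne, Ideal.span_singleton_eq_bot]
      exact_mod_cast (Fact.out : p.Prime).ne_zero
    exact (Ideal.finite_factors hp0).subset fun v hv => Ideal.dvd_span_singleton.mpr hv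
  -- the countable family of bad ideals
  let 𝓑 : Set (Ideal M.𝓡.R) := {B₀} ∪ ⋃ v, ⋃ (hv : v ∈ T), ⋃ n : ℕ, {J v hv n}
  have h𝓑c : 𝓑.Countable :=
    (Set.countable_singleton _).union
      (hT.countable.biUnion fun v hv => Set.countable_iUnion fun n => Set.countable_singleton _)
  have h𝓑Q : ∀ B ∈ 𝓑, ¬ B ≤ Q.asIdeal := by
    rintro B (hB | hB)
    · rw [Set.mem_singleton_iff] at hB
      rw [hB, ← hmemZ]
      exact hQred
    · simp only [Set.mem_iUnion, Set.mem_singleton_iff] at hB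
      obtain ⟨v, hv, n, rfl⟩ := hB
      exact (not_isOfFinOrder_unitsMap_comp_iff Q.asIdeal _).mp (hord v hv) n
  have hQ2 : (2 : WithBot ℕ∞) ≤ ringKrullDim (M.𝓡.R ⧸ Q.asIdeal) :=
    le_trans (by exact_mod_cast (by norm_num : (2 : ℕ) ≤ 3)) hQ3
  obtain ⟨𝔭, h𝔭p, hQ𝔭, h𝔭1, hB𝔭⟩ :=
    Theorems.exists_isPrime_ringKrullDim_quotient_eq_one_forall_not_le Q.asIdeal hQ2 h𝓑c h𝓑Q
  refine ⟨⟨𝔭, h𝔭p⟩, (PrimeSpectrum.asIdeal_le_asIdeal _ _).mp hQ𝔭, h𝔭1, ?_, fun v hv => ?_⟩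
  · rw [hmemZ]
    exact hB𝔭 B₀ (Or.inl rfl)
  · rw [not_isOfFinOrder_unitsMap_comp_iff]
    intro n
    exact hB𝔭 (J v hv n) (Or.inr (Set.mem_iUnion.mpr ⟨v, Set.mem_iUnion.mpr ⟨hv,
      Set.mem_iUnion.mpr ⟨n, rfl⟩⟩⟩))

/-- **Registered alias `stub_patchingPrimeSupply_auxSupply`** of the stub `stub_patchingPrimeSupply` —
the same statement under a name registered by `stub-add` (persistent on the shared crux item, whose
skeleton stubs are displaced whenever a parallel line re-registers its skeleton), so that this file
supports stmt-Langlands-12919 by name + signature at any moment; definitionally `stub_patchingPrimeSupply`.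
[cite: SkinnerWiles1999, §4.3 proof of Prop. 4.1] -/
theorem stub_patchingPrimeSupply_auxSupply :
    ∀ (F : Type) [Field F] [NumberField F], IsTotallyComplex F → Module.finrank ℚ F = 2 →
      ∀ (p : ℕ) [Fact p.Prime], p ≠ 2 →
      ∀ M : ModelData F p, M.IsSWOriented p →
        ∀ Q : PrimeSpectrum M.𝓡.R, IsBigPrime M.𝓡 Q →
          (∀ (v : HeightOneSpectrum (𝓞 F)) (hv : (p : 𝓞 F) ∈ v.asIdeal),
              ¬ IsOfFinOrder ((Units.map (Ideal.Quotient.mk Q.asIdeal : M.𝓡.R →* M.𝓡.R ⧸ Q.asIdeal)).comp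
                (M.𝓡.subChar v hv / M.𝓡.quotChar v hv))) →
          ∃ 𝔭 : PrimeSpectrum M.𝓡.R, Q ≤ 𝔭 ∧ IsPatchingPrime M.𝓡 𝔭 :=
  stub_patchingPrimeSupply

end

end Summit.Langlands.Langlands.Cruxes.ReducibleOrdinaryProModular.FineSelmerCodimensionTwo
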